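import Mathlib
import HarnessLib
import Summits.Ventures.LatticeQCDFlow.Scaling.TorusRankedFraction

/-!
# LatticeQCDFlow / Scaling — free or periodic, the fraction of plaquettes that must ride on the Metropolis
# step of an exact one-plaquette heat-bath autoregression tends to `(d−2)/d`

HONEST FRAMING: exact (Metropolis-corrected) sampling algorithms for lattice gauge theory;
figures of merit are autocorrelation/cost numbers at stated couplings and volumes; no
continuum-physics claim.

Venture `LatticeQCDFlow` (cell pub-lqcd), topic `Scaling`, FANOUT row 30 (lean-1, GEN-25) — OUR WORK on
THEORY-2.md §4 row C5.  `TorusRankedFraction`: on the torus `k_min/#plaquettes → (d−2)/d`.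
`BoxRankedMorseCount`: in the box of side `R = S + 1` the least number outside is
`k_box = C(d,2)S²(S+1)^{d−2} − dS(S+1)^{d−1} + (S+1)^d − 1` of `#K = C(d,2)S²(S+1)^{d−2}` box plaquettes.
Here the free-boundary ratio, as the box grows (`d ≥ 2` written `d = n + 2`, real closed forms):

* **`boxFraction_eq`** — for `S ≥ 1` the ratio is EXACTLY
  `1 − 2(S+1)/((n+1)·S) + 2(S+1)²/((n+2)(n+1)·S²) − 2/((n+2)(n+1)·S²·(S+1)^n)`;
* **`tendsto_boxFraction`** — it tends to `n/(n+2) = (d−2)/d` as `S → ∞`: NONE in two dimensions, A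
  THIRD in three, A HALF in four — the same limit as on the torus.  The dimension (the unit cubes), not
  the periodicity, sets the price of exactness; periodicity only adds `d − 1` plaquettes and the wrap.

No `def`, no `sorry`, nothing cited as a fact beyond the tree.
-/

namespace Summit.Ventures.LatticeQCDFlow.Theory2.Autoregressive

open Finset Filter Topology
open Literature.MathematicalPhysics.QuantumFieldTheory

/-- **The free-boundary ratio in closed form** (`d = n + 2`, `S ≥ 1`, reals):
`(C·S²P − d·S·P(S+1) + P(S+1)² − 1)/(C·S²·P) = 1 − 2(S+1)/((n+1)S) + 2(S+1)²/((n+2)(n+1)S²) − 1/(C S² P)`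
with `C = (n+2)(n+1)/2`, `P = (S+1)^n`. [ours] -/
theorem boxFraction_eq (n : ℕ) {S : ℝ} (hS : 0 < S) :
    (((n + 2 : ℝ) * (n + 1) / 2) * S ^ 2 * (S + 1) ^ n - (n + 2 : ℝ) * S * (S + 1) ^ (n + 1) +
        (S + 1) ^ (n + 2) - 1) / ((((n + 2 : ℝ) * (n + 1) / 2) * S ^ 2 * (S + 1) ^ n)) =
      1 - 2 * (S + 1) / ((n + 1 : ℝ) * S) + 2 * (S + 1) ^ 2 / ((n + 2 : ℝ) * (n + 1) * S ^ 2) -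
        2 / ((n + 2 : ℝ) * (n + 1) * S ^ 2 * (S + 1) ^ n) := by
  have hS1 : (0 : ℝ) < S + 1 := by linarith
  have hP : (0 : ℝ) < (S + 1) ^ n := pow_pos hS1 n
  have hn1 : (0 : ℝ) < n + 1 := by positivity
  have hn2 : (0 : ℝ) < n + 2 := by positivity
  field_simp
  ring

/-- **`k_box/#K → (d−2)/d` as the box grows** (`d = n + 2`): the free-boundary fraction of plaquettes
outside every exact one-plaquette heat-bath autoregression has the same limit as the periodic one
(`TorusRankedFraction.tendsto_kmin_div_card_plaquette`). [ours] -/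
theorem tendsto_boxFraction (n : ℕ) :
    Tendsto (fun S : ℕ => (((n + 2 : ℝ) * (n + 1) / 2) * (S : ℝ) ^ 2 * ((S : ℝ) + 1) ^ n -
        (n + 2 : ℝ) * (S : ℝ) * ((S : ℝ) + 1) ^ (n + 1) + ((S : ℝ) + 1) ^ (n + 2) - 1) /
        ((((n + 2 : ℝ) * (n + 1) / 2) * (S : ℝ) ^ 2 * ((S : ℝ) + 1) ^ n)))
      atTop (𝓝 ((n : ℝ) / (n + 2))) := by
  have hn1 : (0 : ℝ) < n + 1 := by positivity
  have hn2 : (0 : ℝ) < n + 2 := by positivity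
  -- eventually (`S ≥ 1`) the closed form of `boxFraction_eq`
  have hev : ∀ᶠ S : ℕ in atTop, (((n + 2 : ℝ) * (n + 1) / 2) * (S : ℝ) ^ 2 * ((S : ℝ) + 1) ^ n -
        (n + 2 : ℝ) * (S : ℝ) * ((S : ℝ) + 1) ^ (n + 1) + ((S : ℝ) + 1) ^ (n + 2) - 1) /
        ((((n + 2 : ℝ) * (n + 1) / 2) * (S : ℝ) ^ 2 * ((S : ℝ) + 1) ^ n)) =
      1 - 2 * (((S : ℝ) + 1) / (S : ℝ)) / (n + 1 : ℝ) +
        2 * (((S : ℝ) + 1) / (S : ℝ)) ^ 2 / ((n + 2 : ℝ) * (n + 1)) -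
        2 / ((n + 2 : ℝ) * (n + 1)) * (1 / ((S : ℝ) ^ 2 * ((S : ℝ) + 1) ^ n)) := by
    filter_upwards [eventually_ge_atTop 1] with S hS
    have hS' : (0 : ℝ) < S := by exact_mod_cast hS
    rw [boxFraction_eq n hS']
    have hS1 : (0 : ℝ) < (S : ℝ) + 1 := by linarith
    have hP : (0 : ℝ) < ((S : ℝ) + 1) ^ n := pow_pos hS1 n
    field_simp
  rw [tendsto_congr' hev]
  -- `(S+1)/S → 1`, `1/(S²(S+1)^n) → 0`
  have h1 : Tendsto (fun S : ℕ => ((S : ℝ) + 1) / (S : ℝ)) atTop (𝓝 1) := by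
    have h : Tendsto (fun S : ℕ => 1 + 1 / (S : ℝ)) atTop (𝓝 (1 + 0)) :=
      tendsto_const_nhds.add tendsto_one_div_atTop_nhds_zero_nat
    rw [add_zero] at h
    refine h.congr' ?_
    filter_upwards [eventually_ge_atTop 1] with S hS
    have hS' : (S : ℝ) ≠ 0 := by exact_mod_cast (show S ≠ 0 by omega)
    field_simp
  have h2 : Tendsto (fun S : ℕ => 1 / ((S : ℝ) ^ 2 * ((S : ℝ) + 1) ^ n)) atTop (𝓝 0) := by
    have hpow : Tendsto (fun S : ℕ => (S : ℝ) ^ 2 * ((S : ℝ) + 1) ^ n) atTop atTop := by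
      refine tendsto_atTop_mono (fun S => ?_) (tendsto_natCast_atTop_atTop (R := ℝ))
      have hS0 : (0 : ℝ) ≤ (S : ℝ) := Nat.cast_nonneg S
      have hP : (1 : ℝ) ≤ ((S : ℝ) + 1) ^ n := one_le_pow₀ (by linarith)
      have hsq : (S : ℝ) ≤ (S : ℝ) ^ 2 := by
        rcases Nat.eq_zero_or_pos S with h | h
        · subst h; simp
        · have h1 : (1 : ℝ) ≤ S := by exact_mod_cast h
          nlinarith
      calc (S : ℝ) ≤ (S : ℝ) ^ 2 := hsq
        _ = (S : ℝ) ^ 2 * 1 := (mul_one _).symm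
        _ ≤ (S : ℝ) ^ 2 * ((S : ℝ) + 1) ^ n := mul_le_mul_of_nonneg_left hP (pow_nonneg hS0 2)
    exact tendsto_const_nhds.div_atTop hpow
  have hlim : Tendsto (fun S : ℕ => 1 - 2 * (((S : ℝ) + 1) / (S : ℝ)) / (n + 1 : ℝ) +
        2 * (((S : ℝ) + 1) / (S : ℝ)) ^ 2 / ((n + 2 : ℝ) * (n + 1)) -
        2 / ((n + 2 : ℝ) * (n + 1)) * (1 / ((S : ℝ) ^ 2 * ((S : ℝ) + 1) ^ n))) atTop
      (𝓝 (1 - 2 * 1 / (n + 1 : ℝ) + 2 * 1 ^ 2 / ((n + 2 : ℝ) * (n + 1)) - 2 / ((n + 2 : ℝ) * (n + 1)) * 0)) :=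
    ((tendsto_const_nhds.sub ((h1.const_mul 2).div_const _)).add
      (((h1.pow 2).const_mul 2).div_const _)).sub (h2.const_mul _)
  have hval : (1 - 2 * 1 / (n + 1 : ℝ) + 2 * 1 ^ 2 / ((n + 2 : ℝ) * (n + 1)) - 2 / ((n + 2 : ℝ) * (n + 1)) * 0)
      = (n : ℝ) / (n + 2) := by
    field_simp
    ring
  rw [hval] at hlim
  exact hlim

end Summit.Ventures.LatticeQCDFlow.Theory2.Autoregressive
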